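import Summits.HodgeConjecture.HodgeConjecture.Theorems.Ring2HypothesesAtlasSixfoldsAnchors
import Summits.HodgeConjecture.HodgeConjecture.Theorems.Ring2HypothesesWeilComponentsCM
import Literature.AlgebraicGeometry.HodgeTheory.HodgeClassesTwoCMCurvesProducts
import HarnessLib

/-!
# Ring-2 hypotheses layer, part XVIII — MIXED two-CM-curve power anchors: `HC_CM` DISCHARGED at every fibre /
anchor isogenous to `E₁^{a+1} × E₂^{b+1}` (two CM elliptic curves with DIFFERENT CM fields), `B = D` and (G) on
the products and all their powers

HONEST FRAMING (page 1): research route conditional on HC_CM; not a corollary; Q11.4-sentence-2 already refuted in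
dim ≥ 3. `HC_CM` = `Theses.RankFourFaces.CMAbelianHodge` (stmt-HodgeConjecture-3052), a binder BY NAME wherever it
occurs in the cell; it does NOT occur in this file — every row below is UNCONDITIONAL. NOTHING here is a new case of
the Hodge conjecture in print: the content is van Geemen's Theorem 4.3 (Tate / Murasaki / Imai: `Bᵖ(X) = Dᵖ(X)`
for `X` isogenous to a product of elliptic curves) in the kernel scope the Literature seat reached in
`HodgeClassesTwoCMCurvesProducts` (lit gen 10, row L37): TWO elliptic curves `E₁`, `E₂` with complex multiplications
`ψᵢ ≫ ψᵢ = -dᵢ`, `dᵢ ≥ 1`, `d₁ d₂` NOT a square (so `ℚ(√-d₁) ≠ ℚ(√-d₂)`), the products `E₁^{a+1} × E₂^{b+1}`, every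
variety with a SLOT STRUCTURE over the two curves (`TwoCMSlots`, closed under `×` and powers), and — for HC, not
for `B = D` — their isogenous pre-images. Parts VIII / X / XII / XIV-B did the same for ONE CM curve (`A ~ E^{K+1}`);
part XII's honest column (i) named the mixed products `∏ Eᵢ^{nᵢ}` as NOT covered. This file is the Summit-side
USE the map asks for (RING2-MAP §lit gen 10 addendum, "USE" line; seat typer2 owed item (2)).

| row | Lean name | status | what it says |
|---|---|---|---|
| M0 | `dim_twoCM`, `isOfCMType_twoCM`, `isOfCMType_powSucc_twoCM`, `isOfCMType_of_isIsogenous_twoCM`, `isOfCMType_of_isIsogenous_powSucc_twoCM` | PROVED | `E₁^{a+1} × E₂^{b+1}` has dimension `a + b + 2`, is of CM type, and so are its powers and everything isogenous to them (Milne's `IsOfCMType`; no `d₁ d₂` condition) |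
| M1 | `cmHodgeHypothesisAt_of_isIsogenous_twoCM`, `…_powSucc_twoCM` | PROVED | **`HC_CM` HOLDS, as a theorem, at every `A` isogenous to `E₁^{a+1} × E₂^{b+1}` or to a power of it** (Milne's hypothesis (H) at `A`) |
| M2 | `isDivisorGenerated_of_twoCMSlots`, `isDivisorMultiWeilGenerated_of_twoCMSlots`, `isDivisorGenerated_powSucc_twoCM`, `isDivisorGenerated_twoCM`, `isDivisorMultiWeilGenerated_powSucc_twoCM`, `hodgeConjectureFor_powSucc_twoCM`, `hodgeConjectureFor_of_isIsogenous_powSucc_twoCM` | PROVED | **`B = D` (Moonen–Zarhin's condition (D)) and part XIV's generation hypothesis (G) on every slot carrier, on `E₁^{a+1} × E₂^{b+1}` and on ALL ITS POWERS; HC there and on isogenous pre-images** — the atlas's power cells and part XIV / XVII's (G)-rows are INHABITED at mixed CM members of every dimension |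
| M3 | `twoCMPowerAnchor`, `twoCMPowerAnchor_twoCM`, `twoCMPowerAnchor_valid`, `cmAnchor_of_twoCMPowerAnchor`, `algebraicAnchor_of_twoCMPowerAnchor` | 1 schema def + PROVED | the mixed CM-power ANCHOR (schema of part VIII's `cmPowerAnchor`): VALID WITHOUT `HC_CM`, a CM anchor, an algebraic anchor |
| M4 | `mem_cmLocus_of_chart_of_isIsogenous_twoCM`, `mem_anchorLocus_of_chart_of_isIsogenous_twoCM`, `hodgeConjectureFor_fiber_of_invariantCycles_of_twoCM_chart_of_extend` | PROVED | family form: a fibre charted by `A₀ ~ E₁^{a+1} × E₂^{b+1}` lies in `cmLocus ∩ anchorLocus` WITHOUT `HC_CM`; part V's general-fibre engine on (1.1)-families with such a fibre |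
| M5 | `divisorGeneratedCMAnchor_of_chart_twoCM`, `divisorGeneratedCMAnchorOfDim_of_chart_powSucc_twoCM`, `cmAnchorOfDim_of_chart_of_isIsogenous_powSucc_twoCM` | PROVED | at a fibre ISOMORPHIC to (a power of) the product the chart is a DIVISOR-GENERATED CM anchor of parts VII-A / VII-C (any fibre dimension `g`, any degree) |
| M6 | `weilClassesComponent_of_twoCMPowerPointed`, `cmPointedWeilFamiliesComponent_of_twoCMPowerPointed`, `anchoredWeilFamiliesComponent_of_twoCMPowerPointed` | PROVED | rows W1‴ / C8 / anchored of part VIII with the mixed anchor: δ-families pointed at a two-CM-power fibre give the component's class target modulo `WeilVariationalHodgeComponent`, `HC_CM` DISCHARGED |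

HONEST COLUMN. (i) TWO curves with DIFFERENT CM fields only (`¬ IsSquare (d₁ * d₂)` is used by M1–M6 except the
CM-type rows); three or more pairwise non-isogenous CM curves, and non-CM curves (Imai in full), are not in the
tree. For `ℚ(√-d₁) = ℚ(√-d₂)` the one-curve rows of parts VIII / XII apply once an isogeny `A ~ E^{K+1}` is GIVEN
(the tree does not derive `E₁ ~ E₂` from equal CM fields). (ii) `B = D` is proved on slot carriers and is NOT
transported to isogenous pre-images (no isogeny transport of `TwoCMSlots` / `IsDivisorGenerated` in the tree; in
print `B = D` is isogeny invariant, van Geemen 2.5): rows M5 are stated for charts ISOMORPHIC to a carrier, rows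
M3 / M4 (CM type, algebraicity, HC) for isogenous charts. (iii) No Weil-type structure on `E₁^{2r} × E₂^{2m}` is
constructed here; that such products are CM members of `(ℚ(√-d₁), 2(r+m), δ)`-components (`ℚ(√-d₁)` acting on
`E₂²` through `M₂(ℤ) ∋ J`, `J² = -d₁`, signature `(1,1)`) is a REMARK (inference from van Geemen 5.2–5.5), which is
why M6 keeps the pointed leaf `PointedWeilFamiliesComponent n d δ (twoCMPowerAnchor n)` as a HYPOTHESIS. (iv) Products
of two DIFFERENT mixed members `P × P'` are covered only in the bracketings `TwoCMSlots.prod` produces (slot form,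
`isDivisorGenerated_of_twoCMSlots`); the named rows give `P^{N+1}` (`P.powSucc 1 = P × P` by `rfl`).
(v) Part XVII's clause theorems (`codimTwoFromWeilPullbacks_clause_of_isDivisorMultiWeilGenerated`, `codimThree…`)
apply at these members BY NAME (not imported here: XVII is in review).

References: [vanGeemen1994HodgeAV] B. van Geemen, *An introduction to the Hodge conjecture for abelian varieties*,
LNM 1594 (1994), 2.4–2.5, Lemma 3.7, Thm. 4.3, 5.2–5.5, 5.12; [MoonenZarhin1999LowDim] B. Moonen, Yu. Zarhin,
*Hodge classes on abelian varieties of low dimension*, Math. Ann. 315 (1999), (1.8) condition (D), §3 Cor. (3.9)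
(Imai); [Gordon1997] B. Gordon, *A survey of the Hodge conjecture for abelian varieties*, §3 (Tate, Murasaki, Imai);
[Milne1999] J. Milne, *Lefschetz motives and the Tate conjecture*, Compositio 117 (1999), §2 p. 54, §7 p. 72;
[Abdulali1994FamiliesAV] S. Abdulali, Can. J. Math. 46 (1994), (1.1), Lemma 6.2; [Deligne1982HodgeCycles] P. Deligne,
*Hodge cycles on abelian varieties*, LNM 900 (1982), §4–5; [Markman2025SecantWeil] E. Markman, arXiv:2502.03415
(preprint, unrefereed), Thm. 1.5.1.
-/

noncomputable section

set_option linter.dupNamespace false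

open CategoryTheory
open Literature.AlgebraicGeometry Literature.AlgebraicGeometry.Motives
open Literature.AlgebraicGeometry.HodgeTheory
open Literature.AlgebraicTopology.SingularHomology
open Literature.AlgebraicGeometry.Milne1999 (IsOfCMType CMHodgeHypothesisAt isOfCMType_iff_of_isIsogenous)
open Literature.AlgebraicGeometry.VanGeemen1994
open Literature.AlgebraicGeometry.Abdulali1994 (InvariantCyclesHoldFor)
open Literature.Barriers.HodgeConjecture (divisorClassesSpan)
open Summit.HodgeConjecture.HodgeConjecture.WeilTypeLadder
open Summit.HodgeConjecture.HodgeConjecture.Theses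
open Summit.HodgeConjecture.HodgeConjecture.Ring2Transport
open Summit.HodgeConjecture.HodgeConjecture.Ring2.Deform (cmLocus)

namespace Summit.HodgeConjecture.HodgeConjecture.Ring2.Hypotheses

/-! ## §0 Dimension and CM type of `E₁^{a+1} × E₂^{b+1}` and its powers (no condition on `d₁ d₂`) -/

/-- `dim E^{N+1} = N + 1` for a curve `E`. [folklore] -/
theorem dim_powSucc_of_dim_eq_one {E : AbelianVariety ℂ} (hE : E.dim = 1) : ∀ N : ℕ, (E.powSucc N).dim = N + 1
  | 0 => by rw [AbelianVariety.powSucc_zero, hE]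
  | N + 1 => by rw [AbelianVariety.powSucc_succ, AbelianVariety.dim_prod, dim_powSucc_of_dim_eq_one hE N, hE]

section TwoCurves

variable {E₁ E₂ : AbelianVariety ℂ} (hE₁ : E₁.dim = 1) (hE₂ : E₂.dim = 1)
include hE₁ hE₂

/-- **M0 — `dim (E₁^{a+1} × E₂^{b+1}) = a + b + 2`.** [folklore] -/
theorem dim_twoCM (a b : ℕ) : ((E₁.powSucc a).prod (E₂.powSucc b)).dim = a + b + 2 := by
  rw [AbelianVariety.dim_prod, dim_powSucc_of_dim_eq_one hE₁, dim_powSucc_of_dim_eq_one hE₂]; ring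

variable {ψ₁ : E₁ ⟶ E₁} {ψ₂ : E₂ ⟶ E₂} {d₁ d₂ : ℕ} (hd₁ : 0 < d₁) (hd₂ : 0 < d₂)
  (hψ₁ : ψ₁ ≫ ψ₁ = -(d₁ • 𝟙 E₁)) (hψ₂ : ψ₂ ≫ ψ₂ = -(d₂ • 𝟙 E₂))
include hd₁ hd₂ hψ₁ hψ₂

omit hE₁ hE₂ in
/-- **M0 — `E₁^{a+1} × E₂^{b+1}` is of CM type** (each curve is, `EllipticCurve.isOfCMType_of_cm`; powers and
products of CM abelian varieties are CM, `IsOfCMType.prod`). [cite: Milne1999, §2 p. 54] -/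
theorem isOfCMType_twoCM (hE₁ : E₁.dim = 1) (hE₂ : E₂.dim = 1) (a b : ℕ) :
    IsOfCMType ((E₁.powSucc a).prod (E₂.powSucc b)) :=
  (isOfCMType_powSucc (EllipticCurve.isOfCMType_of_cm hE₁ ψ₁ hd₁ hψ₁) a).prod
    (isOfCMType_powSucc (EllipticCurve.isOfCMType_of_cm hE₂ ψ₂ hd₂ hψ₂) b)

/-- **M0 — every power `(E₁^{a+1} × E₂^{b+1})^{N+1}` is of CM type.** [cite: Milne1999, §2 p. 54] -/
theorem isOfCMType_powSucc_twoCM (a b N : ℕ) : IsOfCMType (((E₁.powSucc a).prod (E₂.powSucc b)).powSucc N) :=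
  isOfCMType_powSucc (isOfCMType_twoCM hd₁ hd₂ hψ₁ hψ₂ hE₁ hE₂ a b) N

/-- **M0 — an abelian variety isogenous to `E₁^{a+1} × E₂^{b+1}` is of CM type.** [cite: Milne1999, §2 p. 54] -/
theorem isOfCMType_of_isIsogenous_twoCM (a b : ℕ) {A : AbelianVariety ℂ}
    (hA : A.IsIsogenous ((E₁.powSucc a).prod (E₂.powSucc b))) : IsOfCMType A :=
  (isOfCMType_iff_of_isIsogenous hA).2 (isOfCMType_twoCM hd₁ hd₂ hψ₁ hψ₂ hE₁ hE₂ a b)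

/-- **M0 — an abelian variety isogenous to a power `(E₁^{a+1} × E₂^{b+1})^{N+1}` is of CM type.** [cite: Milne1999, §2 p. 54] -/
theorem isOfCMType_of_isIsogenous_powSucc_twoCM (a b N : ℕ) {A : AbelianVariety ℂ}
    (hA : A.IsIsogenous (((E₁.powSucc a).prod (E₂.powSucc b)).powSucc N)) : IsOfCMType A :=
  (isOfCMType_iff_of_isIsogenous hA).2 (isOfCMType_powSucc_twoCM hE₁ hE₂ hd₁ hd₂ hψ₁ hψ₂ a b N)

/-! ## §1 `HC_CM` is a THEOREM at the mixed CM powers; `B = D`, (G) and HC on all powers (`d₁ d₂` not a square) -/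

/-- **M1 — `HC_CM` HOLDS at every abelian variety isogenous to `E₁^{a+1} × E₂^{b+1}`** (two CM curves with different
CM fields): Milne's hypothesis (H) at `A` is the Literature seat's `hodgeConjectureFor_of_isIsogenous_twoCMCurves`.
[cite: vanGeemen1994HodgeAV, Lemma 3.7 and Thm. 4.3] [cite: MoonenZarhin1999LowDim, §3 Cor. (3.9)] [cite: Milne1999, §7 p. 72] -/
theorem cmHodgeHypothesisAt_of_isIsogenous_twoCM (hsq : ¬ IsSquare (d₁ * d₂)) (a b : ℕ) {A : AbelianVariety ℂ}
    (hA : A.IsIsogenous ((E₁.powSucc a).prod (E₂.powSucc b))) : CMHodgeHypothesisAt A :=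
  fun _ _ ↦ hodgeConjectureFor_of_isIsogenous_twoCMCurves hE₁ hE₂ hd₁ hd₂ hψ₁ hψ₂ hsq a b hA

/-- **M2 — `B = D` ON EVERY POWER `(E₁^{a+1} × E₂^{b+1})^{N+1}`** (Moonen–Zarhin's condition (D) for the mixed
two-CM products; `N = 0` is the product itself, `N = 1` its square): every rational `(p,p)` class is a polynomial in
divisor classes. The Literature seat's slot engine (`hodgeClasses_divisorial_of_twoCMSlots`) on the slot structure
`((self^{a+1}) × (self^{b+1}))^{N+1}` (`twoCMSlots_self`, `TwoCMSlots.prod`, `TwoCMSlots.powSucc`), the two named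
curves packaged as a `Bool`-indexed pair exactly as in `hodgeConjectureFor_of_isIsogenous_twoCMCurves`. UNCONDITIONAL.
[cite: vanGeemen1994HodgeAV, Thm. 4.3] [cite: MoonenZarhin1999LowDim, (1.8) condition (D) and §3 Cor. (3.9)]
[cite: Gordon1997, §3] -/
theorem isDivisorGenerated_powSucc_twoCM (hsq : ¬ IsSquare (d₁ * d₂)) (a b N : ℕ) :
    IsDivisorGenerated (((E₁.powSucc a).prod (E₂.powSucc b)).powSucc N) := by
  let E : Bool → AbelianVariety ℂ := fun t ↦ bif t then E₁ else E₂
  let ψ : ∀ t, E t ⟶ E t := fun t ↦ match t with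
    | true => ψ₁
    | false => ψ₂
  let d : Bool → ℕ := fun t ↦ bif t then d₁ else d₂
  have hE : ∀ t, (E t).dim = 1 := by rintro (_ | _) <;> assumption
  have hd : ∀ t, 0 < d t := by rintro (_ | _) <;> assumption
  have hψ : ∀ t, ψ t ≫ ψ t = -(d t • 𝟙 (E t)) := by rintro (_ | _) <;> assumption
  obtain ⟨ω, hω, hω0, hgen⟩ := exists_generators hE
  intro p c hc hpp
  exact hodgeClasses_divisorial_of_twoCMSlots (E := E) (ψ := ψ) (d := d) hE hd hψ hsq hω hω0 hgen
    ((((twoCMSlots_self (ψ := ψ) true (hgen true)).powSucc a).prod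
      ((twoCMSlots_self (ψ := ψ) false (hgen false)).powSucc b)).powSucc N) p c hc hpp

/-- **M2 — `B = D` on `E₁^{a+1} × E₂^{b+1}` itself** (the `N = 0` instance, `powSucc_zero` is `rfl`).
[cite: vanGeemen1994HodgeAV, Thm. 4.3] -/
theorem isDivisorGenerated_twoCM (hsq : ¬ IsSquare (d₁ * d₂)) (a b : ℕ) :
    IsDivisorGenerated ((E₁.powSucc a).prod (E₂.powSucc b)) :=
  isDivisorGenerated_powSucc_twoCM hE₁ hE₂ hd₁ hd₂ hψ₁ hψ₂ hsq a b 0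

/-- **M2 — part XIV's generation hypothesis (G) HOLDS on every power of `E₁^{a+1} × E₂^{b+1}`** (XIV-B (A1):
`B = D ⟹ (G)`): the (G)-rows of parts XIV / XVII have UNCONDITIONAL mixed-CM members in every dimension `≥ 2`.
[cite: vanGeemen1994HodgeAV, Thm. 4.3 and §2.4–2.5] -/
theorem isDivisorMultiWeilGenerated_powSucc_twoCM (hsq : ¬ IsSquare (d₁ * d₂)) (a b N : ℕ) :
    IsDivisorMultiWeilGenerated (((E₁.powSucc a).prod (E₂.powSucc b)).powSucc N) :=
  isDivisorMultiWeilGenerated_of_isDivisorGenerated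
    (isDivisorGenerated_powSucc_twoCM hE₁ hE₂ hd₁ hd₂ hψ₁ hψ₂ hsq a b N)

/-- **M2 — the Hodge conjecture for every power `(E₁^{a+1} × E₂^{b+1})^{N+1}`** (the atlas's power cells at their
mixed-CM members; van Geemen §2.4 "`D = B` implies HC", the tree's `hodgeConjectureFor_of_isDivisorGenerated`).
UNCONDITIONAL. [cite: vanGeemen1994HodgeAV, §2.4 and Thm. 4.3] -/
theorem hodgeConjectureFor_powSucc_twoCM (hsq : ¬ IsSquare (d₁ * d₂)) (a b N : ℕ) :
    HodgeConjectureFor (((E₁.powSucc a).prod (E₂.powSucc b)).powSucc N).dim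
      (((E₁.powSucc a).prod (E₂.powSucc b)).powSucc N).X :=
  hodgeConjectureFor_of_isDivisorGenerated _ (isDivisorGenerated_powSucc_twoCM hE₁ hE₂ hd₁ hd₂ hψ₁ hψ₂ hsq a b N)

/-- **M2 — the Hodge conjecture for every abelian variety ISOGENOUS to a power `(E₁^{a+1} × E₂^{b+1})^{N+1}`**
(van Geemen's Lemma 3.7, the tree's `HodgeConjectureFor.of_isIsogenous`). UNCONDITIONAL.
[cite: vanGeemen1994HodgeAV, Lemma 3.7 and Thm. 4.3] -/
theorem hodgeConjectureFor_of_isIsogenous_powSucc_twoCM (hsq : ¬ IsSquare (d₁ * d₂)) (a b N : ℕ)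
    {A : AbelianVariety ℂ} (hA : A.IsIsogenous (((E₁.powSucc a).prod (E₂.powSucc b)).powSucc N)) :
    HodgeConjectureFor A.dim A.X :=
  HodgeConjectureFor.of_isIsogenous hA (hodgeConjectureFor_powSucc_twoCM hE₁ hE₂ hd₁ hd₂ hψ₁ hψ₂ hsq a b N)

/-- **M1 — `HC_CM` HOLDS at every abelian variety isogenous to a power `(E₁^{a+1} × E₂^{b+1})^{N+1}`.**
[cite: vanGeemen1994HodgeAV, Lemma 3.7 and Thm. 4.3] [cite: Milne1999, §7 p. 72] -/
theorem cmHodgeHypothesisAt_of_isIsogenous_powSucc_twoCM (hsq : ¬ IsSquare (d₁ * d₂)) (a b N : ℕ)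
    {A : AbelianVariety ℂ} (hA : A.IsIsogenous (((E₁.powSucc a).prod (E₂.powSucc b)).powSucc N)) :
    CMHodgeHypothesisAt A :=
  fun _ _ ↦ hodgeConjectureFor_of_isIsogenous_powSucc_twoCM hE₁ hE₂ hd₁ hd₂ hψ₁ hψ₂ hsq a b N hA

end TwoCurves

/-! ## §2 Slot form (any bracketing): `B = D` and (G) on every `TwoCMSlots` carrier -/

section Slots

variable {E : Bool → AbelianVariety ℂ} {ψ : ∀ b, E b ⟶ E b} {d : Bool → ℕ}

/-- **M2 (slot form) — `B = D` on every variety with a slot structure over two CM curves with different CM fields**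
(the Literature predicate `IsDivisorGenerated` read off `hodgeClasses_divisorial_of_twoCMSlots`; all products of
copies of `E tt`, `E ff` in any bracketing carry slots). [cite: vanGeemen1994HodgeAV, Thm. 4.3 and §2.4–2.5] -/
theorem isDivisorGenerated_of_twoCMSlots (hE : ∀ b, (E b).dim = 1) (hd : ∀ b, 0 < d b)
    (hψ : ∀ b, ψ b ≫ ψ b = -(d b • 𝟙 (E b))) (hsq : ¬ IsSquare (d true * d false))
    {ω : ∀ b, complexBetti (E b).X 1} (hω : ∀ b, IsOfHodgeType (E b).dim (E b).X 1 1 0 (ω b))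
    (hω0 : ∀ b, ω b ≠ 0)
    (hωgen : ∀ b (u : complexBetti (E b).X 1), IsOfHodgeType (E b).dim (E b).X 1 1 0 u → ∃ c : ℂ, u = c • ω b)
    {B : AbelianVariety ℂ} (hB : TwoCMSlots E ψ ω B) : IsDivisorGenerated B :=
  fun p c hc hpp ↦ hodgeClasses_divisorial_of_twoCMSlots hE hd hψ hsq hω hω0 hωgen hB p c hc hpp

/-- **M2 (slot form) — (G) on every `TwoCMSlots` carrier.** [cite: vanGeemen1994HodgeAV, Thm. 4.3] -/
theorem isDivisorMultiWeilGenerated_of_twoCMSlots (hE : ∀ b, (E b).dim = 1) (hd : ∀ b, 0 < d b)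
    (hψ : ∀ b, ψ b ≫ ψ b = -(d b • 𝟙 (E b))) (hsq : ¬ IsSquare (d true * d false))
    {ω : ∀ b, complexBetti (E b).X 1} (hω : ∀ b, IsOfHodgeType (E b).dim (E b).X 1 1 0 (ω b))
    (hω0 : ∀ b, ω b ≠ 0)
    (hωgen : ∀ b (u : complexBetti (E b).X 1), IsOfHodgeType (E b).dim (E b).X 1 1 0 u → ∃ c : ℂ, u = c • ω b)
    {B : AbelianVariety ℂ} (hB : TwoCMSlots E ψ ω B) : IsDivisorMultiWeilGenerated B :=
  isDivisorMultiWeilGenerated_of_isDivisorGenerated (isDivisorGenerated_of_twoCMSlots hE hd hψ hsq hω hω0 hωgen hB)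

end Slots

/-! ## §3 The mixed CM-power anchor: VALID WITHOUT `HC_CM` -/

variable {𝒳 S : SchemeOver ℂ}

/-- **The two-CM-power anchor** (schema of part VIII's `cmPowerAnchor`; the class argument is not used): the marked
fibre is charted by an abelian `2n`-fold `A₀` isogenous to `E₁^{a+1} × E₂^{b+1}` for elliptic curves `E₁`, `E₂`
with complex multiplications `ψᵢ ≫ ψᵢ = -dᵢ`, `dᵢ ≥ 1`, `d₁ d₂` not a square.
[cite: vanGeemen1994HodgeAV, Thm. 4.3 and 5.5] [cite: MoonenZarhin1999LowDim, §3 Cor. (3.9)] -/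
def twoCMPowerAnchor (n : ℕ) (X : SchemeOver ℂ) (_x : complexBetti X (2 * n)) : Prop :=
  ∃ (A₀ E₁ E₂ : AbelianVariety ℂ) (ψ₁ : E₁ ⟶ E₁) (ψ₂ : E₂ ⟶ E₂) (d₁ d₂ a b : ℕ), Nonempty (A₀.X ≅ X) ∧
    A₀.dim = 2 * n ∧ E₁.dim = 1 ∧ E₂.dim = 1 ∧ 0 < d₁ ∧ 0 < d₂ ∧ ψ₁ ≫ ψ₁ = -(d₁ • 𝟙 E₁) ∧
    ψ₂ ≫ ψ₂ = -(d₂ • 𝟙 E₂) ∧ ¬ IsSquare (d₁ * d₂) ∧ A₀.IsIsogenous ((E₁.powSucc a).prod (E₂.powSucc b))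

section TwoCurves

variable {E₁ E₂ : AbelianVariety ℂ} (hE₁ : E₁.dim = 1) (hE₂ : E₂.dim = 1) {ψ₁ : E₁ ⟶ E₁} {ψ₂ : E₂ ⟶ E₂}
  {d₁ d₂ : ℕ} (hd₁ : 0 < d₁) (hd₂ : 0 < d₂) (hψ₁ : ψ₁ ≫ ψ₁ = -(d₁ • 𝟙 E₁)) (hψ₂ : ψ₂ ≫ ψ₂ = -(d₂ • 𝟙 E₂))
include hE₁ hE₂ hd₁ hd₂ hψ₁ hψ₂

/-- ANTI-VACUITY: `E₁^{a+1} × E₂^{b+1}` itself carries the two-CM-power anchor (any chart, identity isogeny).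
[cite: vanGeemen1994HodgeAV, Thm. 4.3] -/
theorem twoCMPowerAnchor_twoCM (hsq : ¬ IsSquare (d₁ * d₂)) (a b n : ℕ)
    (hdim : ((E₁.powSucc a).prod (E₂.powSucc b)).dim = 2 * n) {X : SchemeOver ℂ}
    (e₀ : ((E₁.powSucc a).prod (E₂.powSucc b)).X ≅ X) (x : complexBetti X (2 * n)) : twoCMPowerAnchor n X x :=
  ⟨_, E₁, E₂, ψ₁, ψ₂, d₁, d₂, a, b, ⟨e₀⟩, hdim, hE₁, hE₂, hd₁, hd₂, hψ₁, hψ₂, hsq,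
    Motives.AbelianVariety.IsIsogenous.refl _⟩

/-- **M4 — a fibre charted by `A₀ ~ E₁^{a+1} × E₂^{b+1}` is a CM point of the family** (`cmLocus`; no condition on
`d₁ d₂`). [cite: Milne1999, §2 p. 54] -/
theorem mem_cmLocus_of_chart_of_isIsogenous_twoCM {f : 𝒳 ⟶ S} {n : ℕ} {s : ComplexPoints S}
    (A₀ : AbelianVariety ℂ) (e₀ : A₀.X ≅ fiberOver f s) (hdim : A₀.dim = n) (a b : ℕ)
    (hiso : A₀.IsIsogenous ((E₁.powSucc a).prod (E₂.powSucc b))) : s ∈ cmLocus f n :=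
  ⟨A₀, ⟨e₀⟩, hdim, isOfCMType_of_isIsogenous_twoCM hE₁ hE₂ hd₁ hd₂ hψ₁ hψ₂ a b hiso⟩

/-- **M4 — such a fibre is an ANCHOR, WITHOUT `HC_CM`**: `s ∈ anchorLocus f n` (part V's
`cmLocus_subset_anchorLocus_of_HC_CM` consumes `HC_CM`; here van Geemen 4.3 replaces it).
[cite: vanGeemen1994HodgeAV, Lemma 3.7 and Thm. 4.3] [cite: MoonenZarhin1999LowDim, §3 Cor. (3.9)] -/
theorem mem_anchorLocus_of_chart_of_isIsogenous_twoCM (hsq : ¬ IsSquare (d₁ * d₂)) {f : 𝒳 ⟶ S} {n : ℕ}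
    {s : ComplexPoints S} (A₀ : AbelianVariety ℂ) (e₀ : A₀.X ≅ fiberOver f s) (hdim : A₀.dim = n) (a b : ℕ)
    (hiso : A₀.IsIsogenous ((E₁.powSucc a).prod (E₂.powSucc b))) : s ∈ anchorLocus f n := by
  subst hdim
  exact mem_anchorLocus_of_chart e₀
    (hodgeConjectureFor_of_isIsogenous_twoCMCurves hE₁ hE₂ hd₁ hd₂ hψ₁ hψ₂ hsq a b hiso)

/-- **M4, general-fibre form — part VI's target (D1) restricted to (1.1)-families with a two-CM-power fibre is a
THEOREM modulo (1.1), WITHOUT `HC_CM`**: HC at every Hodge-generic fibre. The OPEN content is (1.1) on the family.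
[cite: Abdulali1994FamiliesAV, (1.1) and proof of Lemma 6.2 (p. 1131)] [cite: vanGeemen1994HodgeAV, Thm. 4.3] -/
theorem hodgeConjectureFor_fiber_of_invariantCycles_of_twoCM_chart_of_extend (hsq : ¬ IsSquare (d₁ * d₂))
    {f : 𝒳 ⟶ S} {n : ℕ} (hf : IsSmoothProjectiveFamily f n) (hIC : InvariantCyclesHoldFor f n)
    {s₀ : ComplexPoints S} (A₀ : AbelianVariety ℂ) (e₀ : A₀.X ≅ fiberOver f s₀) (hdim : A₀.dim = n) (a b : ℕ)
    (hiso : A₀.IsIsogenous ((E₁.powSucc a).prod (E₂.powSucc b))) {s : ComplexPoints S}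
    (hs : HodgeClassesExtendAt f n s) : HodgeConjectureFor n (fiberOver f s) :=
  hodgeConjectureFor_fiber_of_invariantCycles_of_anchor_of_extend hf hIC
    ⟨s₀, mem_anchorLocus_of_chart_of_isIsogenous_twoCM hE₁ hE₂ hd₁ hd₂ hψ₁ hψ₂ hsq A₀ e₀ hdim a b hiso⟩ hs

/-- **M5 — at a fibre ISOMORPHIC to a power `(E₁^{a+1} × E₂^{b+1})^{N+1}` of dimension `2n` the chart is a
DIVISOR-GENERATED CM anchor of part VII-A** (`Hdg = Div` on the chart, M2; CM type, M0).
[cite: vanGeemen1994HodgeAV, Thm. 4.3 and 5.5] -/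
theorem divisorGeneratedCMAnchor_of_chart_twoCM (hsq : ¬ IsSquare (d₁ * d₂)) (a b N n : ℕ)
    (hdim : (((E₁.powSucc a).prod (E₂.powSucc b)).powSucc N).dim = 2 * n) {X : SchemeOver ℂ}
    (e₀ : (((E₁.powSucc a).prod (E₂.powSucc b)).powSucc N).X ≅ X) (x : complexBetti X (2 * n)) :
    divisorGeneratedCMAnchor n X x :=
  ⟨_, ⟨e₀⟩, hdim, isOfCMType_powSucc_twoCM hE₁ hE₂ hd₁ hd₂ hψ₁ hψ₂ a b N,
    fun y hyQ hyH ↦ isDivisorGenerated_powSucc_twoCM hE₁ hE₂ hd₁ hd₂ hψ₁ hψ₂ hsq a b N n y hyQ hyH⟩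

/-- **M5 (part VII-C, any fibre dimension `g`, any degree `2p`) — the same chart is a divisor-generated CM anchor
`divisorGeneratedCMAnchorOfDim g p`** of the CM-field-general components. [cite: Deligne1982HodgeCycles, §5]
[cite: vanGeemen1994HodgeAV, Thm. 4.3] -/
theorem divisorGeneratedCMAnchorOfDim_of_chart_powSucc_twoCM (hsq : ¬ IsSquare (d₁ * d₂)) (a b N g p : ℕ)
    (hdim : (((E₁.powSucc a).prod (E₂.powSucc b)).powSucc N).dim = g) {X : SchemeOver ℂ}
    (e₀ : (((E₁.powSucc a).prod (E₂.powSucc b)).powSucc N).X ≅ X) (x : complexBetti X (2 * p)) :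
    divisorGeneratedCMAnchorOfDim g p X x :=
  ⟨_, ⟨e₀⟩, hdim, isOfCMType_powSucc_twoCM hE₁ hE₂ hd₁ hd₂ hψ₁ hψ₂ a b N,
    fun y hyQ hyH ↦ isDivisorGenerated_powSucc_twoCM hE₁ hE₂ hd₁ hd₂ hψ₁ hψ₂ hsq a b N p y hyQ hyH⟩

/-- **M5 (part VII-C) — a fibre charted by `A₀` ISOGENOUS to a power of the product is a CM anchor `cmAnchorOfDim g p`**
(CM type transports along isogenies; `B = D` is not transported here — honest column (ii)). [cite: Milne1999, §2 p. 54] -/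
theorem cmAnchorOfDim_of_chart_of_isIsogenous_powSucc_twoCM {g p : ℕ} {X : SchemeOver ℂ}
    {x : complexBetti X (2 * p)} (A₀ : AbelianVariety ℂ) (e₀ : A₀.X ≅ X) (hdim : A₀.dim = g) (a b N : ℕ)
    (hiso : A₀.IsIsogenous (((E₁.powSucc a).prod (E₂.powSucc b)).powSucc N)) : cmAnchorOfDim g p X x :=
  ⟨A₀, ⟨e₀⟩, hdim, isOfCMType_of_isIsogenous_powSucc_twoCM hE₁ hE₂ hd₁ hd₂ hψ₁ hψ₂ a b N hiso⟩

end TwoCurves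

/-- **M3 — the two-CM-power anchor is VALID WITHOUT `HC_CM`**: a rational `(n,n)` class on a fibre charted by
`A₀ ~ E₁^{a+1} × E₂^{b+1}` is algebraic (van Geemen 4.3 on the product, Lemma 3.7, transport along the chart).
[cite: vanGeemen1994HodgeAV, Lemma 3.7 and Thm. 4.3] [cite: MoonenZarhin1999LowDim, §3 Cor. (3.9)] -/
theorem twoCMPowerAnchor_valid (n : ℕ) :
    ∀ (X : SchemeOver ℂ) (x : complexBetti X (2 * n)), twoCMPowerAnchor n X x → IsRationalClass x →
      IsOfHodgeType (2 * n) X (2 * n) n n x → x ∈ algebraicClasses X n := by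
  rintro X x ⟨A₀, E₁, E₂, ψ₁, ψ₂, d₁, d₂, a, b, ⟨e₀⟩, hA₀dim, hE₁, hE₂, hd₁, hd₂, hψ₁, hψ₂, hsq, hiso⟩ hxQ hxH
  have hHC : HodgeConjectureFor (2 * n) X := (hodgeConjectureFor_iff_of_iso e₀).1
    (hA₀dim ▸ hodgeConjectureFor_of_isIsogenous_twoCMCurves hE₁ hE₂ hd₁ hd₂ hψ₁ hψ₂ hsq a b hiso)
  exact hHC.2 n x hxQ hxH

/-- **M3 — a two-CM-power anchor is a CM anchor** (part VII-A's `cmAnchor`). [cite: Milne1999, §2 p. 54] -/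
theorem cmAnchor_of_twoCMPowerAnchor {n : ℕ} {X : SchemeOver ℂ} {x : complexBetti X (2 * n)}
    (h : twoCMPowerAnchor n X x) : cmAnchor n X x := by
  obtain ⟨A₀, E₁, E₂, ψ₁, ψ₂, d₁, d₂, a, b, he₀, hA₀dim, hE₁, hE₂, hd₁, hd₂, hψ₁, hψ₂, -, hiso⟩ := h
  exact ⟨A₀, he₀, hA₀dim, isOfCMType_of_isIsogenous_twoCM hE₁ hE₂ hd₁ hd₂ hψ₁ hψ₂ a b hiso⟩

/-- **M3 — a two-CM-power anchor is an algebraic anchor** for rational `(n,n)` classes (row M3 restated).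
[cite: vanGeemen1994HodgeAV, Thm. 4.3] -/
theorem algebraicAnchor_of_twoCMPowerAnchor {n : ℕ} {X : SchemeOver ℂ} {x : complexBetti X (2 * n)}
    (h : twoCMPowerAnchor n X x) (hxQ : IsRationalClass x) (hxH : IsOfHodgeType (2 * n) X (2 * n) n n x) :
    algebraicAnchor n X x :=
  twoCMPowerAnchor_valid n X x h hxQ hxH

/-! ## §4 Rows of part VIII with the mixed anchor: δ-families pointed at a two-CM-power fibre (`HC_CM` DISCHARGED) -/

/-- **M6 (row W1‴, mixed) — the class target of the component `(ℚ(√-d), 2n, δ)` WITHOUT `HC_CM`** from δ-families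
pointed at a two-CM-power fibre and the δ-restricted Weil-confined variational Hodge statement: part VII-A's
abstract-anchor engine with the anchor validated by row M3. HONEST COLUMN: `HC_CM` DISCHARGED; the content is
`WeilVariationalHodgeComponent n d δ` (OPEN) plus the pointed family leaf, kept as the HYPOTHESIS `hP` (that mixed
products `E₁^{2r} × E₂^{2m}` are members of such components is a remark, module docstring (iii)).
[cite: Markman2025SecantWeil, Thm. 1.5.1 (strategy; preprint, unrefereed)] [cite: vanGeemen1994HodgeAV, Thm. 4.3, 5.5 and 5.12] -/
theorem weilClassesComponent_of_twoCMPowerPointed {n d : ℕ} {δ : weilNormResidueGroup d}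
    (hP : PointedWeilFamiliesComponent n d δ (twoCMPowerAnchor n)) (hV : WeilVariationalHodgeComponent n d δ) :
    WeilClassesComponent n d δ :=
  weilClassesComponent_of_pointed_of_variational (twoCMPowerAnchor_valid n) hP hV

/-- **M6 (row C8, mixed) — a two-CM-power-pointed δ-family is a CM-pointed δ-family** (no `HC_CM`).
[cite: Milne1999, §2 p. 54] [cite: Deligne1982HodgeCycles, §4–5] -/
theorem cmPointedWeilFamiliesComponent_of_twoCMPowerPointed {n d : ℕ} {δ : weilNormResidueGroup d}
    (hP : PointedWeilFamiliesComponent n d δ (twoCMPowerAnchor n)) : CMPointedWeilFamiliesComponent n d δ :=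
  PointedWeilFamiliesComponent.mono (fun _ _ h ↦ cmAnchor_of_twoCMPowerAnchor h) hP

/-- **M6 (anchored, mixed) — a two-CM-power-pointed δ-family is an ANCHORED δ-family, WITHOUT `HC_CM`** (contrast
part VII-A's `anchoredWeilFamiliesComponent_of_HC_CM_of_cmPointed`). [cite: vanGeemen1994HodgeAV, Thm. 4.3] -/
theorem anchoredWeilFamiliesComponent_of_twoCMPowerPointed {n d : ℕ} {δ : weilNormResidueGroup d}
    (hP : PointedWeilFamiliesComponent n d δ (twoCMPowerAnchor n)) : AnchoredWeilFamiliesComponent n d δ := by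
  intro A φ hAdim hX hφ e a haQ ha0 hδ c hcQ hcH hc hc0
  obtain ⟨𝒳, S, f, s₁, s₀, ι, W, hf, h𝒳, hS, hirrS, hsm, hW, hch, hread, hanch⟩ :=
    hP A φ hAdim hX hφ e a haQ ha0 hδ c hcQ hcH hc hc0
  exact ⟨𝒳, S, f, s₁, s₀, ι, W, hf, h𝒳, hS, hirrS, hsm, hW, hch, hread,
    twoCMPowerAnchor_valid n _ _ hanch (hW s₀).1 (hW s₀).2⟩

/-! ## §5 Audit — the HC-shaped rows are CASES of the Hodge conjecture (forward contract) -/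

/-- Forward contract: rows M2 (HC on the powers and their isogenous pre-images) are instances of the Hodge
conjecture for smooth projective varieties; `B = D`, (G) and the anchor rows are Hodge theory / bookkeeping proved
above, not assumed. [cite: Deligne2000, §1] -/
theorem twoCM_rows_of_hodgeConjecture
    (h : ∀ ⦃n : ℕ⦄ ⦃Y : SchemeOver ℂ⦄, IsSmoothProjective n Y → HodgeConjectureFor n Y) (A : AbelianVariety ℂ) :
    HodgeConjectureFor A.dim A.X :=
  h (AbelianVariety.isSmoothProjective_holds (A := A))

end Summit.HodgeConjecture.HodgeConjecture.Ring2.Hypotheses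

end
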